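import Literature.MathematicalPhysics.QuantumLattice.HubbardTTPrimeThermalPressureSpinSectors
import Literature.MathematicalPhysics.QuantumLattice.SectorPartitionFnGrandCanonicalBound
import Literature.MathematicalPhysics.QuantumLattice.ApproximatingHamiltonianProofs
import HarnessLib

/-!
# The grand-canonical pressure of the 2D `t–t'` Hubbard model exists and is the Legendre transform of the
# spin-resolved canonical pressure: `P(β; t,t',U; μ) = sup_{(n↑,n↓)} [p(β; n↑, n↓) + βμ(n↑ + n↓)]`

Topic `MathematicalPhysics/QuantumLattice` (family `hubbard`); sequel of `HubbardTTPrimeThermalPressureSpinSectors.lean`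
(the spin-resolved canonical free entropy per site `p(β; t,t',U; x, y) = pressureTT'₂ β t t' U x y`, `(x,y) = (n↑,n↓)`,
with its volume-free density legs) and of `SectorPartitionFnGrandCanonicalBound.lean` (`e^{βμ(a+b)} Z(a,b) ≤ Ξ`).
For the `L × L` torus with Hamiltonian `H_L = hubbardRectTorusTT' L L t t' U` and `Ξ_L(β,μ) = Re Z_β(H_L − μN)`:

* §1 the SECTOR DECOMPOSITION of the grand-canonical trace (any finite `Λ`, any sector-preserving Hermitian `A`):
  `Re Z_β(A − μN) = Σ_{a,b ≤ |Λ|} e^{βμ(a+b)} Re Z_β(A; a, b)` (`partitionFn_sub_smul_totalNumber_re_eq_sum`), hence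
  `log Ξ ≤ 2 log(|Λ|+1) + max_{a,b} [βμ(a+b) + log Z(a,b)]` (`log_partitionFn_grandCanonical_le_of_forall`);
* §2 UNIFORMITY of the canonical limit over the sectors (`eventually_forall_sector_le_sSup`): for every `ε > 0`,
  eventually in `L`, `βμ(a+b)/L² + L⁻² log Z_L(a,b) ≤ S + ε` for ALL `a, b ≤ L²`, where
  `S = sup_{x,y ∈ [0,1)} [p(x,y) + βμ(x+y)]` — the finite-volume canonical free entropies are equi-continuous in the
  densities up to `o(1)`: `log Z_L(a,b) − log C(L²,a) − log C(L²,b)` is `βκ`-Lipschitz in `(a,b)` by the volume-free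
  transfer (`κ = 4|t|+4|t'|+U`), `|log C(L²,a) − L² H_b(a/L²)| ≤ 2 log(L²+1)`, and `H_b` is uniformly continuous; a
  finite net of densities then carries the pointwise limits;
* §3 **`tendsto_gcPressureTT'`**: `L⁻² log Ξ_L(β,μ) → gcPressureTT' β t t' U μ := sup_{x,y ∈ [0,1)} [p(x,y) + βμ(x+y)]`
  (`β ≥ 0`, `U ≥ 0`, every real `μ`) — the grand-canonical pressure EXISTS and is the Legendre transform of the
  spin-resolved canonical pressure; corollaries `pressureTT'₂_add_le_gcPressureTT'`,
  `pressureTT'_add_le_gcPressureTT'` (`p(n) + βμn ≤ P(μ)`, the canonical number of record), `gcPressureTT'_le_iff`,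
  and the certificate dictionary `gcPressureTT'_le_of_eventually` / `le_gcPressureTT'_of_eventually` (grand-canonical
  ceilings / floors along any `Ls → ∞` are bounds on the number).

Not here: the reduction of the supremum to the `S^z = 0` diagonal (`sup_n [pressureTT' n + βμn]`), which needs the
joint concavity and the spin-flip symmetry of `p(x,y)`; the Zeeman-field version.

Everything is PROVED; one real definition (`gcPressureTT'`, an `sSup` with its `tendsto` next to it) and one
finite-volume abbreviation (`torusGCPressureTT'`), no named fact.

## Mathlib / tree search

REUSED: `exp_mul_partitionFn_spinSector_le_grandCanonical` (`SectorPartitionFnGrandCanonicalBound`),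
`re_trace_spinSectorProj_mul_gibbsWeight_eq` (`SpinSectorPartitionFnTransfer`), `spinSectorProj`,
`totalNumber_eq_diagonal`, `PreservesSectors.add/.smul/.diagonal`, `partitionFn_add_smul_one`
(`ApproximatingHamiltonianProofs`), `tendsto_spinSectorPressureTT'`, `pressureTT'₂_le_apriori`, `pressureTT'₂_half_half`,
`log_partitionFn_sub_log_choose_up_steps_mem_local/_down_steps_…` (`HubbardTTPrimeThermalPressureSpinSectors`),
`le_log_choose`, `log_choose_le_mul_binEntropy`, Mathlib `IsCompact.uniformContinuousOn_of_continuous`,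
`Metric.uniformContinuousOn_iff`, `Filter.eventually_all`, `Real.binEntropy_continuous`.
`lean search 'gcPressure|grandCanonical.*tendsto'`: nothing for the Hubbard torus (2026-08-27).

## References

* D. Ruelle, *Statistical Mechanics: Rigorous Results* (1969), §3.4 (equivalence of the canonical and grand-canonical
  pressures of lattice systems). [cite: Ruelle1969, §3.4]
* R. B. Israel, *Convexity in the Theory of Lattice Gases* (1979), Thm. I.2.4, Lemma II.3.1. [cite: Israel1979, Thm. I.2.4]
-/

noncomputable section

namespace Literature.MathematicalPhysics.QuantumLattice

open Matrix Finset HubbardWave0 Literature.Probability.LatticeModels LiebThm1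
open _root_.Filter
open scoped _root_.Topology ComplexOrder BigOperators

/-! ### §1 The sector decomposition of the grand-canonical trace -/

section SectorDecomposition

variable {Λ : Type*} [LinearOrder Λ] [Fintype Λ]

/-- `Σ_{a ≤ |Λ|} Σ_{b ≤ |Λ|} P_{a,b} = 1`: every configuration lies in exactly one spin sector.
[cite: LiebPRL1989, proof of Theorem 1] -/
theorem sum_sum_spinSectorProj_eq_one :
    ∑ a ∈ Finset.range (Fintype.card Λ + 1), ∑ b ∈ Finset.range (Fintype.card Λ + 1),
      (spinSectorProj a b : Matrix (Finset (Orb Λ)) (Finset (Orb Λ)) ℂ) = 1 := by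
  ext s u
  simp only [Matrix.sum_apply, spinSectorProj, diagonal_apply, Matrix.one_apply]
  by_cases hsu : s = u
  · subst hsu
    simp only [if_true]
    have hup : (upPart s).card < Fintype.card Λ + 1 := Nat.lt_succ_of_le (Finset.card_le_univ _)
    have hdown : (downPart s).card < Fintype.card Λ + 1 := Nat.lt_succ_of_le (Finset.card_le_univ _)
    rw [Finset.sum_eq_single_of_mem (upPart s).card (Finset.mem_range.2 hup)]
    · rw [Finset.sum_eq_single_of_mem (downPart s).card (Finset.mem_range.2 hdown)]
      · simp
      · intro b _ hb
        rw [if_neg (fun h => hb h.2.symm)]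
    · intro a _ ha
      exact Finset.sum_eq_zero fun b _ => by rw [if_neg (fun h => ha h.1.symm)]
  · simp [hsu]

/-- The compression of `A − μN` to the sector `(a, b)` is the compression of `A` shifted by `−μ(a+b)`.
[cite: Ruelle1969, §3.4] -/
theorem spinSectorHamiltonian_sub_smul_totalNumber (a b : ℕ) (A : Matrix (Finset (Orb Λ)) (Finset (Orb Λ)) ℂ)
    (μ : ℝ) :
    spinSectorHamiltonian a b (A - (μ : ℂ) • totalNumber) =
      spinSectorHamiltonian a b A + ((-(μ * (a + b)) : ℝ) : ℂ) • 1 := by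
  ext ⟨s, hs⟩ ⟨u, hu⟩
  simp only [spinSectorHamiltonian, submatrix_apply, Matrix.sub_apply, Matrix.add_apply, Matrix.smul_apply,
    totalNumber_eq_diagonal, diagonal_apply, Matrix.one_apply, Subtype.mk.injEq, smul_eq_mul]
  by_cases hsu : s = u
  · subst hsu
    simp only [if_true, hs.1, hs.2]
    push_cast
    ring
  · simp [hsu]

/-- Hence `Re Z_β((A − μN)|_{(a,b)}) = e^{βμ(a+b)} Re Z_β(A|_{(a,b)})`. [cite: Ruelle1969, §3.4] -/
theorem partitionFn_spinSector_sub_smul_totalNumber_re (a b : ℕ) (A : Matrix (Finset (Orb Λ)) (Finset (Orb Λ)) ℂ)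
    (β μ : ℝ) :
    (partitionFn β (spinSectorHamiltonian a b (A - (μ : ℂ) • totalNumber))).re =
      Real.exp (β * μ * (a + b)) * (partitionFn β (spinSectorHamiltonian a b A)).re := by
  rw [spinSectorHamiltonian_sub_smul_totalNumber, partitionFn_add_smul_one, Complex.re_ofReal_mul]
  congr 1
  congr 1
  ring

/-- `A − μN` preserves the spin sectors when `A` does. [cite: LiebPRL1989, Remark (2)] -/
theorem preservesSectors_sub_smul_totalNumber {A : Matrix (Finset (Orb Λ)) (Finset (Orb Λ)) ℂ}
    (hP : PreservesSectors A) (μ : ℂ) : PreservesSectors (A - μ • totalNumber) := by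
  rw [sub_eq_add_neg, ← neg_smul, totalNumber_eq_diagonal]
  exact hP.add ((PreservesSectors.diagonal _).smul _)

/-- **Sector decomposition of the grand-canonical partition function**: for a Hermitian sector-preserving `A`,
`Re Z_β(A − μN) = Σ_{a ≤ |Λ|} Σ_{b ≤ |Λ|} e^{βμ(a+b)} Re Z_β(A; a, b)`. [cite: Ruelle1969, §3.4] -/
theorem partitionFn_sub_smul_totalNumber_re_eq_sum {A : Matrix (Finset (Orb Λ)) (Finset (Orb Λ)) ℂ}
    (hP : PreservesSectors A) (β μ : ℝ) :
    (partitionFn β (A - (μ : ℂ) • totalNumber)).re =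
      ∑ a ∈ Finset.range (Fintype.card Λ + 1), ∑ b ∈ Finset.range (Fintype.card Λ + 1),
        Real.exp (β * μ * (a + b)) * (partitionFn β (spinSectorHamiltonian a b A)).re := by
  set K := A - (μ : ℂ) • totalNumber with hK
  have hKP : PreservesSectors K := preservesSectors_sub_smul_totalNumber hP μ
  have h1 : partitionFn β K = ((∑ a ∈ Finset.range (Fintype.card Λ + 1),
      ∑ b ∈ Finset.range (Fintype.card Λ + 1),
        (spinSectorProj a b : Matrix (Finset (Orb Λ)) (Finset (Orb Λ)) ℂ)) * gibbsWeight β K).trace := by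
    rw [sum_sum_spinSectorProj_eq_one, Matrix.one_mul]; rfl
  rw [h1, Finset.sum_mul, Matrix.trace_sum, Complex.re_sum]
  refine Finset.sum_congr rfl fun a _ => ?_
  rw [Finset.sum_mul, Matrix.trace_sum, Complex.re_sum]
  refine Finset.sum_congr rfl fun b _ => ?_
  rw [re_trace_spinSectorProj_mul_gibbsWeight_eq hKP, hK, partitionFn_spinSector_sub_smul_totalNumber_re]

/-- **The grand-canonical trace is within a polynomial factor of its largest sector term**: if
`βμ(a+b) + log Re Z_β(A; a,b) ≤ B` for all `a, b ≤ |Λ|` (nonempty sectors have positive partition functions, the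
empty ones vanish), then `log Re Z_β(A − μN) ≤ 2 log(|Λ|+1) + B`. [cite: Ruelle1969, §3.4] -/
theorem log_partitionFn_grandCanonical_le_of_forall {A : Matrix (Finset (Orb Λ)) (Finset (Orb Λ)) ℂ}
    (hA : A.IsHermitian) (hP : PreservesSectors A) (β μ : ℝ) {B : ℝ}
    (hB : ∀ a b : ℕ, a ≤ Fintype.card Λ → b ≤ Fintype.card Λ →
      Real.exp (β * μ * (a + b)) * (partitionFn β (spinSectorHamiltonian a b A)).re ≤ Real.exp B) :
    Real.log (partitionFn β (A - (μ : ℂ) • totalNumber)).re ≤ 2 * Real.log ((Fintype.card Λ : ℝ) + 1) + B := by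
  have hK : (A - (μ : ℂ) • totalNumber).IsHermitian :=
    hA.sub (totalNumber_isHermitian.smul (by rw [isSelfAdjoint_iff, Complex.star_def, Complex.conj_ofReal]))
  have hpos : 0 < (partitionFn β (A - (μ : ℂ) • totalNumber)).re := partitionFn_re_pos hK β
  rw [partitionFn_sub_smul_totalNumber_re_eq_sum hP β μ] at hpos ⊢
  have hsum : ∑ a ∈ Finset.range (Fintype.card Λ + 1), ∑ b ∈ Finset.range (Fintype.card Λ + 1),
      Real.exp (β * μ * (a + b)) * (partitionFn β (spinSectorHamiltonian a b A)).re ≤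
      ((Fintype.card Λ : ℝ) + 1) ^ 2 * Real.exp B := by
    calc _ ≤ ∑ a ∈ Finset.range (Fintype.card Λ + 1), ∑ b ∈ Finset.range (Fintype.card Λ + 1), Real.exp B :=
          Finset.sum_le_sum fun a ha => Finset.sum_le_sum fun b hb =>
            hB a b (Nat.lt_succ_iff.1 (Finset.mem_range.1 ha)) (Nat.lt_succ_iff.1 (Finset.mem_range.1 hb))
      _ = ((Fintype.card Λ : ℝ) + 1) ^ 2 * Real.exp B := by
          rw [Finset.sum_const, Finset.sum_const, Finset.card_range, smul_smul, nsmul_eq_mul]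
          push_cast; ring
  have hc : (0 : ℝ) < (Fintype.card Λ : ℝ) + 1 := by positivity
  calc Real.log _ ≤ Real.log (((Fintype.card Λ : ℝ) + 1) ^ 2 * Real.exp B) := Real.log_le_log hpos hsum
    _ = 2 * Real.log ((Fintype.card Λ : ℝ) + 1) + B := by
        rw [Real.log_mul (by positivity) (Real.exp_pos _).ne', Real.log_pow, Real.log_exp]; push_cast; ring

end SectorDecomposition

namespace ThermodynamicLimit

/-! ### §2 The grand-canonical pressure of the torus; uniformity of the canonical limit over the sectors -/

/-- `halfRectN n L ≤ n L²/2` (`0 ≤ n`). [folklore] -/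
private theorem halfRectN_le_half_mul_sq' (n : ℝ) (hn0 : 0 ≤ n) (L : ℕ) :
    (halfRectN n L : ℝ) ≤ n / 2 * (L : ℝ) ^ 2 := by
  unfold halfRectN
  have h := Nat.floor_le (a := n * (L : ℝ) ^ 2 / 2) (by positivity)
  linarith

/-- `n L²/2 − 1 < halfRectN n L`. [folklore] -/
private theorem half_mul_sq_sub_one_lt_halfRectN' (n : ℝ) (L : ℕ) :
    n / 2 * (L : ℝ) ^ 2 - 1 < (halfRectN n L : ℝ) := by
  unfold halfRectN
  have := Nat.lt_floor_add_one (n * (L : ℝ) ^ 2 / 2)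
  linarith

/-- `k_L(n)/L² → n/2`. [folklore] -/
private theorem tendsto_halfRectN_div_sq₄ {n : ℝ} (hn0 : 0 ≤ n) :
    Tendsto (fun L : ℕ => (halfRectN n L : ℝ) / (L : ℝ) ^ 2) atTop (𝓝 (n / 2)) := by
  have h := (tendsto_rectN_div_sq hn0).div_const 2
  refine h.congr fun L => ?_
  have e : rectN n L = 2 * halfRectN n L := rfl
  rw [e]
  push_cast
  ring


/-- **The finite-volume grand-canonical pressure** of the `L × L` torus:
`P_L(β; t,t',U; μ) = L⁻² log Re Z_β(hubbardRectTorusTT' L L t t' U − μN)`. [cite: Ruelle1969, §3.4] -/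
def torusGCPressureTT' (β t t' U μ : ℝ) (L : ℕ) : ℝ :=
  Real.log (partitionFn β (hubbardRectTorusTT' L L t t' U - (μ : ℂ) • totalNumber)).re / (L : ℝ) ^ 2

/-- **The grand-canonical pressure of the 2D `t–t'` Hubbard model** as the Legendre transform of the spin-resolved
canonical pressure: `P(β; t,t',U; μ) = sup_{x, y ∈ [0,1)} [p(β; t,t',U; x, y) + βμ(x + y)]`; it is the limit of
`torusGCPressureTT'` (`tendsto_torusGCPressureTT'`). [cite: Ruelle1969, §3.4] -/
def gcPressureTT' (β t t' U μ : ℝ) : ℝ :=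
  sSup ((fun z : ℝ × ℝ => pressureTT'₂ β t t' U z.1 z.2 + β * μ * (z.1 + z.2)) '' (Set.Ico (0 : ℝ) 1 ×ˢ Set.Ico (0 : ℝ) 1))

/-- A net point within `1/(N+1)` of every `u ∈ [0,1]`, inside `[0, 1)`. [folklore] -/
private theorem exists_net_point (N : ℕ) {u : ℝ} (hu0 : 0 ≤ u) (hu1 : u ≤ 1) :
    ∃ i : Fin (N + 1), |u - (i : ℕ) / ((N : ℝ) + 1)| ≤ 1 / ((N : ℝ) + 1) := by
  have hN : (0 : ℝ) < (N : ℝ) + 1 := by positivity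
  set m : ℕ := ⌊u * ((N : ℝ) + 1)⌋₊ with hm
  have hm0 : (m : ℝ) ≤ u * ((N : ℝ) + 1) := Nat.floor_le (by positivity)
  have hm1 : u * ((N : ℝ) + 1) < (m : ℝ) + 1 := Nat.lt_floor_add_one _
  have key : ∀ k : ℕ, |u * ((N : ℝ) + 1) - k| ≤ 1 → |u - (k : ℝ) / ((N : ℝ) + 1)| ≤ 1 / ((N : ℝ) + 1) := by
    intro k hk
    have e : u - (k : ℝ) / ((N : ℝ) + 1) = (u * ((N : ℝ) + 1) - k) / ((N : ℝ) + 1) := by field_simp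
    rw [e, abs_div, abs_of_pos hN]
    exact div_le_div_of_nonneg_right hk hN.le
  by_cases hmN : m ≤ N
  · exact ⟨⟨m, Nat.lt_succ_of_le hmN⟩, key m (abs_le.2 ⟨by linarith, by linarith⟩)⟩
  · refine ⟨⟨N, Nat.lt_succ_self N⟩, key N ?_⟩
    have hmN' : (N : ℝ) + 1 ≤ m := by exact_mod_cast (show N + 1 ≤ m by omega)
    have hu : u = 1 := by
      by_contra hne
      have hlt : u < 1 := lt_of_le_of_ne hu1 hne
      have : u * ((N : ℝ) + 1) < (N : ℝ) + 1 := by nlinarith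
      linarith
    rw [hu, abs_le]
    constructor <;> linarith

/-- The binomial entropy, two-sided (`0 < M`, `a ≤ M`): `M H_b(a/M) − 2 log(M+1) ≤ log C(M,a) ≤ M H_b(a/M)`.
[cite: Israel1979, Lemma II.3.1] -/
private theorem log_choose_mem_binEntropy {M a : ℕ} (hM : 0 < M) (ha : a ≤ M) :
    (M : ℝ) * Real.binEntropy ((a : ℝ) / M) - 2 * Real.log ((M : ℝ) + 1) ≤ Real.log (M.choose a) ∧
      Real.log (M.choose a) ≤ (M : ℝ) * Real.binEntropy ((a : ℝ) / M) :=
  ⟨le_log_choose ha hM, log_choose_le_mul_binEntropy ha⟩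

/-- `c log(x²+1) ≤ η x²` eventually (`log = o(id)`). [folklore] -/
private theorem eventually_mul_log_sq_add_one_le {c η : ℝ} (hc : 0 ≤ c) (hη : 0 < η) :
    ∀ᶠ L : ℕ in atTop, c * Real.log ((L : ℝ) ^ 2 + 1) ≤ η * (L : ℝ) ^ 2 := by
  have h2 : Tendsto (fun L : ℕ => (L : ℝ) ^ 2 + 1) atTop atTop :=
    tendsto_atTop_add_const_right _ 1 ((tendsto_pow_atTop two_ne_zero).comp tendsto_natCast_atTop_atTop)
  have hc' : (0 : ℝ) < η / (2 * (c + 1)) := by positivity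
  have h3 := h2.eventually (Real.isLittleO_log_id_atTop.def hc')
  filter_upwards [h3, eventually_ge_atTop 1] with L hL hL1
  have hL1' : (1 : ℝ) ≤ (L : ℝ) ^ 2 := by
    have : (1 : ℝ) ≤ L := by exact_mod_cast hL1
    nlinarith
  have hlog0 : 0 ≤ Real.log ((L : ℝ) ^ 2 + 1) := Real.log_nonneg (by linarith)
  simp only [id, Real.norm_eq_abs] at hL
  rw [abs_of_nonneg hlog0, abs_of_nonneg (by positivity)] at hL
  -- `c log ≤ c η/(2(c+1)) (L²+1) ≤ η/2 (L²+1) ≤ η L²`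
  have h1 : c * Real.log ((L : ℝ) ^ 2 + 1) ≤ c * (η / (2 * (c + 1)) * ((L : ℝ) ^ 2 + 1)) :=
    mul_le_mul_of_nonneg_left hL hc
  have h2' : c * (η / (2 * (c + 1))) ≤ η / 2 := by
    have hc1 : (c + 1) ≠ 0 := by positivity
    calc c * (η / (2 * (c + 1))) = c * η / ((c + 1) * 2) := by ring
      _ ≤ (c + 1) * η / ((c + 1) * 2) := div_le_div_of_nonneg_right (by nlinarith) (by positivity)
      _ = η / 2 := mul_div_mul_left η 2 hc1
  have h3' : c * (η / (2 * (c + 1)) * ((L : ℝ) ^ 2 + 1)) ≤ η / 2 * ((L : ℝ) ^ 2 + 1) := by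
    rw [← mul_assoc]; exact mul_le_mul_of_nonneg_right h2' (by positivity)
  nlinarith [h1, h3', hL1', hη]

/-- The final bookkeeping of the uniformity lemma, pure linear arithmetic. [folklore] -/
private theorem gc_assembly_arith {Z₁ Z₂ A B κ m δ' lg ε P BXY S BM L2 : ℝ}
    (hZab : Z₁ ≤ Z₂ + A + B + κ * (2 * (δ' * L2 + 1)))
    (hent : A + B ≤ ε / 8 * L2 + ε / 8 * L2 + 4 * lg)
    (hnet : Z₂ ≤ (P + ε / 8) * L2)
    (hμ : BM ≤ BXY * L2 + m * (2 * (δ' * L2 + 1) + 2))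
    (hv1 : 8 * lg ≤ ε / 8 * L2) (hv2 : (κ + m + 1) * 4 ≤ ε / 8 * L2)
    (hS : (P + BXY) * L2 ≤ S * L2) (he1 : (κ + m + 1) * (2 * δ') * L2 ≤ ε / 8 * L2)
    (hκ : 0 ≤ κ) (hm : 0 ≤ m) (hδL : 0 ≤ δ' * L2) :
    BM + Z₁ ≤ (S + ε) * L2 := by
  have h1 : κ * (2 * (δ' * L2 + 1)) ≤ (κ + m + 1) * (2 * δ') * L2 + 2 * κ := by nlinarith
  have h2 : m * (2 * (δ' * L2 + 1) + 2) ≤ (κ + m + 1) * (2 * δ') * L2 + 4 * m := by nlinarith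
  nlinarith

section GC

variable {β : ℝ} (hβ : 0 ≤ β) (t t' : ℝ) {U : ℝ} (hU : 0 ≤ U) (μ : ℝ)
include hβ hU

/-- The Legendre set is bounded above (a-priori ceiling of `p(x,y)` plus `2|βμ|`). [cite: Ruelle1969, §3.4] -/
theorem bddAbove_legendreSet :
    BddAbove ((fun z : ℝ × ℝ => pressureTT'₂ β t t' U z.1 z.2 + β * μ * (z.1 + z.2)) ''
      (Set.Ico (0 : ℝ) 1 ×ˢ Set.Ico (0 : ℝ) 1)) := by
  refine ⟨Real.log 4 + β * (8 * |t| + 8 * |t'|) + Real.log 2 + β * (4 * |t| + 4 * |t'| + U) + 2 * |β * μ|, ?_⟩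
  rintro _ ⟨⟨x, y⟩, ⟨hx, hy⟩, rfl⟩
  have h1 := pressureTT'₂_le_apriori hβ t t' hU hx.1 hx.2 hy.1 hy.2
  have h2 : β * μ * (x + y) ≤ 2 * |β * μ| := by
    have hxy : |x + y| ≤ 2 := by rw [abs_le]; constructor <;> linarith [hx.1, hx.2, hy.1, hy.2]
    calc β * μ * (x + y) ≤ |β * μ * (x + y)| := le_abs_self _
      _ = |β * μ| * |x + y| := abs_mul _ _
      _ ≤ |β * μ| * 2 := mul_le_mul_of_nonneg_left hxy (abs_nonneg _)
      _ = 2 * |β * μ| := by ring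
  simp only
  linarith

/-- **Every spin sector is below the Legendre supremum**: `p(x,y) + βμ(x+y) ≤ P(μ)` for `x, y ∈ [0,1)`.
[cite: Ruelle1969, §3.4] -/
theorem pressureTT'₂_add_le_gcPressureTT' {x y : ℝ} (hx0 : 0 ≤ x) (hx1 : x < 1) (hy0 : 0 ≤ y) (hy1 : y < 1) :
    pressureTT'₂ β t t' U x y + β * μ * (x + y) ≤ gcPressureTT' β t t' U μ :=
  le_csSup (bddAbove_legendreSet hβ t t' hU μ) ⟨(x, y), ⟨⟨hx0, hx1⟩, ⟨hy0, hy1⟩⟩, rfl⟩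

/-- `P(μ) ≤ q` iff every sector term is `≤ q`. [cite: Ruelle1969, §3.4] -/
theorem gcPressureTT'_le_iff {q : ℝ} :
    gcPressureTT' β t t' U μ ≤ q ↔
      ∀ x y : ℝ, 0 ≤ x → x < 1 → 0 ≤ y → y < 1 → pressureTT'₂ β t t' U x y + β * μ * (x + y) ≤ q := by
  have hne : ((fun z : ℝ × ℝ => pressureTT'₂ β t t' U z.1 z.2 + β * μ * (z.1 + z.2)) ''
      (Set.Ico (0 : ℝ) 1 ×ˢ Set.Ico (0 : ℝ) 1)).Nonempty :=
    ⟨_, ⟨(0, 0), ⟨⟨le_rfl, one_pos⟩, ⟨le_rfl, one_pos⟩⟩, rfl⟩⟩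
  rw [gcPressureTT', csSup_le_iff (bddAbove_legendreSet hβ t t' hU μ) hne]
  constructor
  · intro h x y hx0 hx1 hy0 hy1
    exact h _ ⟨(x, y), ⟨⟨hx0, hx1⟩, ⟨hy0, hy1⟩⟩, rfl⟩
  · rintro h _ ⟨⟨x, y⟩, ⟨hx, hy⟩, rfl⟩
    exact h x y hx.1 hx.2 hy.1 hy.2

/-- **The canonical number of record is below the Legendre supremum**: `pressureTT' β t t' U n + βμn ≤ P(μ)`
(`0 ≤ n < 2`; the diagonal sector `x = y = n/2`). [cite: Ruelle1969, §3.4] -/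
theorem pressureTT'_add_le_gcPressureTT' {n : ℝ} (hn0 : 0 ≤ n) (hn2 : n < 2) :
    pressureTT' β t t' U n + β * μ * n ≤ gcPressureTT' β t t' U μ := by
  have h := pressureTT'₂_add_le_gcPressureTT' hβ t t' hU μ (x := n / 2) (y := n / 2) (by linarith) (by linarith)
    (by linarith) (by linarith)
  rwa [pressureTT'₂_half_half hβ t t' hU hn0 hn2, show n / 2 + n / 2 = n by ring] at h

/-! #### The finite-volume moduli -/

/-- **Equicontinuity of the finite-volume canonical free entropies in the up number**: on the `L × L` torus,
`|[log Z(a',b) − log C(L²,a')] − [log Z(a,b) − log C(L²,a)]| ≤ β(4|t|+4|t'|+U)|a' − a|`. [cite: Ruelle1969, §3.4] -/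
theorem abs_interactionEntropy_sub_le_fst (L : ℕ) {a a' b : ℕ} (ha : a ≤ L * L) (ha' : a' ≤ L * L) (hb : b ≤ L * L) :
    |(Real.log (partitionFn β (spinSectorHamiltonian a' b (hubbardRectTorusTT' L L t t' U))).re -
        Real.log ((L * L).choose a')) -
      (Real.log (partitionFn β (spinSectorHamiltonian a b (hubbardRectTorusTT' L L t t' U))).re -
        Real.log ((L * L).choose a))| ≤
      β * (4 * |t| + 4 * |t'| + U) * |((a' : ℝ)) - a| := by
  have hκ : β * (4 * |t| + 4 * |t'| + max (-U) 0) ≤ β * (4 * |t| + 4 * |t'| + U) := by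
    rw [max_eq_right (by linarith : -U ≤ 0)]; exact mul_le_mul_of_nonneg_left (by linarith) hβ
  have hκ' : β * (4 * |t| + 4 * |t'| + max U 0) = β * (4 * |t| + 4 * |t'| + U) := by rw [max_eq_left hU]
  rcases le_total a a' with h | h
  · obtain ⟨d, rfl⟩ : ∃ d, a' = a + d := ⟨a' - a, by omega⟩
    obtain ⟨h₁, h₂⟩ := log_partitionFn_sub_log_choose_up_steps_mem_local L L t t' U hβ hb d a ha'
    rw [hκ'] at h₁
    have hd0 : (0 : ℝ) ≤ d := by positivity
    have e : (((a + d : ℕ) : ℝ)) - a = d := by push_cast; ring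
    rw [e, abs_of_nonneg hd0, abs_le]
    constructor
    · linarith
    · exact h₂.trans (mul_le_mul_of_nonneg_right hκ hd0)
  · obtain ⟨d, rfl⟩ : ∃ d, a = a' + d := ⟨a - a', by omega⟩
    obtain ⟨h₁, h₂⟩ := log_partitionFn_sub_log_choose_up_steps_mem_local L L t t' U hβ hb d a' ha
    rw [hκ'] at h₁
    have hd0 : (0 : ℝ) ≤ d := by positivity
    have e : ((a' : ℝ)) - ((a' + d : ℕ) : ℝ) = -d := by push_cast; ring
    rw [e, abs_neg, abs_of_nonneg hd0, abs_le]
    constructor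
    · have := h₂.trans (mul_le_mul_of_nonneg_right hκ hd0); linarith
    · linarith

/-- **Equicontinuity in the down number** (same constant). [cite: Ruelle1969, §3.4] -/
theorem abs_interactionEntropy_sub_le_snd (L : ℕ) {a b b' : ℕ} (ha : a ≤ L * L) (hb : b ≤ L * L)
    (hb' : b' ≤ L * L) :
    |(Real.log (partitionFn β (spinSectorHamiltonian a b' (hubbardRectTorusTT' L L t t' U))).re -
        Real.log ((L * L).choose b')) -
      (Real.log (partitionFn β (spinSectorHamiltonian a b (hubbardRectTorusTT' L L t t' U))).re -
        Real.log ((L * L).choose b))| ≤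
      β * (4 * |t| + 4 * |t'| + U) * |((b' : ℝ)) - b| := by
  have hκ : β * (4 * |t| + 4 * |t'| + max (-U) 0) ≤ β * (4 * |t| + 4 * |t'| + U) := by
    rw [max_eq_right (by linarith : -U ≤ 0)]; exact mul_le_mul_of_nonneg_left (by linarith) hβ
  have hκ' : β * (4 * |t| + 4 * |t'| + max U 0) = β * (4 * |t| + 4 * |t'| + U) := by rw [max_eq_left hU]
  rcases le_total b b' with h | h
  · obtain ⟨d, rfl⟩ : ∃ d, b' = b + d := ⟨b' - b, by omega⟩
    obtain ⟨h₁, h₂⟩ := log_partitionFn_sub_log_choose_down_steps_mem_local L L t t' U hβ ha d b hb'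
    rw [hκ'] at h₁
    have hd0 : (0 : ℝ) ≤ d := by positivity
    have e : (((b + d : ℕ) : ℝ)) - b = d := by push_cast; ring
    rw [e, abs_of_nonneg hd0, abs_le]
    constructor
    · linarith
    · exact h₂.trans (mul_le_mul_of_nonneg_right hκ hd0)
  · obtain ⟨d, rfl⟩ : ∃ d, b = b' + d := ⟨b - b', by omega⟩
    obtain ⟨h₁, h₂⟩ := log_partitionFn_sub_log_choose_down_steps_mem_local L L t t' U hβ ha d b' hb
    rw [hκ'] at h₁
    have hd0 : (0 : ℝ) ≤ d := by positivity
    have e : ((b' : ℝ)) - ((b' + d : ℕ) : ℝ) = -d := by push_cast; ring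
    rw [e, abs_neg, abs_of_nonneg hd0, abs_le]
    constructor
    · have := h₂.trans (mul_le_mul_of_nonneg_right hκ hd0); linarith
    · linarith
set_option maxHeartbeats 400000 in
/-- **Uniformity of the canonical limit over the spin sectors.** For every `ε > 0`, eventually in `L`: for ALL
`a, b ≤ L²`, `βμ(a+b)/L² + L⁻² log Z_L(a,b) ≤ sup_{x,y ∈ [0,1)} [p(x,y) + βμ(x+y)] + ε`. [cite: Ruelle1969, §3.4] -/
theorem eventually_forall_sector_le_sSup {ε : ℝ} (hε : 0 < ε) :
    ∀ᶠ L : ℕ in atTop, ∀ a b : ℕ, a ≤ L * L → b ≤ L * L →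
      (β * μ * (a + b) + Real.log (partitionFn β (spinSectorHamiltonian a b
        (hubbardRectTorusTT' L L t t' U))).re) / (L : ℝ) ^ 2 ≤ gcPressureTT' β t t' U μ + ε := by
  -- constants
  set κ : ℝ := β * (4 * |t| + 4 * |t'| + U) with hκ
  have hκ0 : 0 ≤ κ := by rw [hκ]; positivity
  set S := gcPressureTT' β t t' U μ with hS
  -- uniform continuity of the binary entropy on `[0,1]`
  have huc : UniformContinuousOn Real.binEntropy (Set.Icc (0 : ℝ) 1) :=
    isCompact_Icc.uniformContinuousOn_of_continuous Real.binEntropy_continuous.continuousOn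
  obtain ⟨δ₁, hδ₁, hδ⟩ := Metric.uniformContinuousOn_iff.1 huc (ε / 8) (by positivity)
  -- the net scale `δ' = 1/(N+1) ≤ min(δ₁/2, ε/(8(κ+|βμ|+1)))`
  obtain ⟨N, hN⟩ := exists_nat_gt (max (2 / δ₁) (16 * (κ + |β * μ| + 1) / ε))
  have hNpos : (0 : ℝ) < (N : ℝ) + 1 := by positivity
  set δ' : ℝ := 1 / ((N : ℝ) + 1) with hδ'
  have hδ'pos : 0 < δ' := by rw [hδ']; positivity
  have hδ'1 : δ' ≤ δ₁ / 2 := by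
    have h1 : 2 / δ₁ < (N : ℝ) + 1 := by linarith [le_max_left (2 / δ₁) (16 * (κ + |β * μ| + 1) / ε)]
    rw [hδ', div_le_iff₀ hNpos]
    rw [div_lt_iff₀ hδ₁] at h1
    linarith
  have hδ'2 : (κ + |β * μ| + 1) * (2 * δ') ≤ ε / 8 := by
    have h1 : 16 * (κ + |β * μ| + 1) / ε < (N : ℝ) + 1 := by
      linarith [le_max_right (2 / δ₁) (16 * (κ + |β * μ| + 1) / ε)]
    rw [div_lt_iff₀ hε] at h1
    rw [hδ']
    have : (κ + |β * μ| + 1) * (2 * (1 / ((N : ℝ) + 1))) = 2 * (κ + |β * μ| + 1) / ((N : ℝ) + 1) := by ring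
    rw [this, div_le_iff₀ hNpos]
    linarith
  -- the net points `u_i = i δ'`, `i ≤ N`, lie in `[0, 1)`
  have hu0 : ∀ i : Fin (N + 1), 0 ≤ ((i : ℕ) : ℝ) * δ' := fun i => by positivity
  have hu1 : ∀ i : Fin (N + 1), ((i : ℕ) : ℝ) * δ' < 1 := fun i => by
    have : ((i : ℕ) : ℝ) ≤ N := by exact_mod_cast Nat.lt_succ_iff.1 i.isLt
    rw [hδ', mul_one_div, div_lt_one hNpos]; linarith
  -- pointwise convergence at the net points, all at once
  have hpt : ∀ᶠ L : ℕ in atTop, ∀ ij : Fin (N + 1) × Fin (N + 1),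
      spinSectorPressureTT' β t t' U (((ij.1 : ℕ) : ℝ) * δ') (((ij.2 : ℕ) : ℝ) * δ') L ≤
        pressureTT'₂ β t t' U (((ij.1 : ℕ) : ℝ) * δ') (((ij.2 : ℕ) : ℝ) * δ') + ε / 8 := by
    refine eventually_all.2 fun ij => ?_
    have h := tendsto_spinSectorPressureTT' hβ t t' hU (hu0 ij.1) (hu1 ij.1) (hu0 ij.2) (hu1 ij.2)
    exact h.eventually (Iic_mem_nhds (by linarith))
  -- the volume thresholds
  have hvol1 : ∀ᶠ L : ℕ in atTop, 8 * Real.log ((L : ℝ) ^ 2 + 1) ≤ ε / 8 * (L : ℝ) ^ 2 :=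
    eventually_mul_log_sq_add_one_le (by norm_num) (by positivity)
  have hvol2 : ∀ᶠ L : ℕ in atTop, (κ + |β * μ| + 1) * 4 ≤ ε / 8 * (L : ℝ) ^ 2 ∧ 2 ≤ δ₁ / 2 * (L : ℝ) ^ 2 := by
    have h2 : Tendsto (fun L : ℕ => (L : ℝ) ^ 2) atTop atTop :=
      (tendsto_pow_atTop two_ne_zero).comp tendsto_natCast_atTop_atTop
    filter_upwards [h2.eventually_ge_atTop (max ((κ + |β * μ| + 1) * 4 / (ε / 8)) (2 / (δ₁ / 2)))] with L hL
    constructor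
    · have h := (div_le_iff₀ (by positivity : (0 : ℝ) < ε / 8)).1 ((le_max_left _ _).trans hL)
      linarith
    · have h := (div_le_iff₀ (by positivity : (0 : ℝ) < δ₁ / 2)).1 ((le_max_right _ _).trans hL)
      linarith
  filter_upwards [hpt, hvol1, hvol2, eventually_ge_atTop 1] with L hptL hv1 ⟨hv2, hv3⟩ hL1 a b ha hb
  -- notation at volume `L`
  have hL2 : (0 : ℝ) < (L : ℝ) ^ 2 := by
    have : (1 : ℝ) ≤ L := by exact_mod_cast hL1
    positivity
  have hMM : ((L * L : ℕ) : ℝ) = (L : ℝ) ^ 2 := by push_cast; ring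
  have hMpos : 0 < L * L := Nat.mul_pos hL1 hL1
  set M : ℕ := L * L with hMdef
  -- densities of the given sector and their net points
  have hua : 0 ≤ (a : ℝ) / (L : ℝ) ^ 2 ∧ (a : ℝ) / (L : ℝ) ^ 2 ≤ 1 := by
    constructor
    · positivity
    · rw [div_le_one hL2, ← hMM]; exact_mod_cast ha
  have hub : 0 ≤ (b : ℝ) / (L : ℝ) ^ 2 ∧ (b : ℝ) / (L : ℝ) ^ 2 ≤ 1 := by
    constructor
    · positivity
    · rw [div_le_one hL2, ← hMM]; exact_mod_cast hb
  obtain ⟨i, hi⟩ := exists_net_point N hua.1 hua.2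
  obtain ⟨j, hj⟩ := exists_net_point N hub.1 hub.2
  have ei : ((i : ℕ) : ℝ) / ((N : ℝ) + 1) = ((i : ℕ) : ℝ) * δ' := by rw [hδ']; ring
  have ej : ((j : ℕ) : ℝ) / ((N : ℝ) + 1) = ((j : ℕ) : ℝ) * δ' := by rw [hδ']; ring
  rw [ei] at hi
  rw [ej] at hj
  set xi : ℝ := ((i : ℕ) : ℝ) * δ' with hxi
  set yj : ℝ := ((j : ℕ) : ℝ) * δ' with hyj
  set a' : ℕ := halfRectN (2 * xi) L with ha'def
  set b' : ℕ := halfRectN (2 * yj) L with hb'def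
  have ha'M : a' < L * L := halfRectN_lt_sq (by linarith [hu0 i]) (by linarith [hu1 i]) hL1
  have hb'M : b' < L * L := halfRectN_lt_sq (by linarith [hu0 j]) (by linarith [hu1 j]) hL1
  -- `|a' − xi L²| ≤ 1`, `|b' − yj L²| ≤ 1`
  have ha'1 : (a' : ℝ) ≤ xi * (L : ℝ) ^ 2 ∧ xi * (L : ℝ) ^ 2 - 1 < a' := by
    have h1 := halfRectN_le_half_mul_sq' (2 * xi) (by linarith [hu0 i]) L
    have h2 := half_mul_sq_sub_one_lt_halfRectN' (2 * xi) L
    constructor <;> [linarith; linarith]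
  have hb'1 : (b' : ℝ) ≤ yj * (L : ℝ) ^ 2 ∧ yj * (L : ℝ) ^ 2 - 1 < b' := by
    have h1 := halfRectN_le_half_mul_sq' (2 * yj) (by linarith [hu0 j]) L
    have h2 := half_mul_sq_sub_one_lt_halfRectN' (2 * yj) L
    constructor <;> [linarith; linarith]
  -- distances `|a − a'| ≤ δ' L² + 1`
  have hdista : |((a' : ℝ)) - a| ≤ δ' * (L : ℝ) ^ 2 + 1 := by
    have h1 : |(a : ℝ) - xi * (L : ℝ) ^ 2| ≤ δ' * (L : ℝ) ^ 2 := by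
      have e : (a : ℝ) - xi * (L : ℝ) ^ 2 = ((a : ℝ) / (L : ℝ) ^ 2 - xi) * (L : ℝ) ^ 2 := by field_simp
      rw [e, abs_mul, abs_of_pos hL2]
      exact mul_le_mul_of_nonneg_right (by rwa [hδ']) hL2.le
    have h2 : |(a' : ℝ) - xi * (L : ℝ) ^ 2| ≤ 1 := by rw [abs_le]; constructor <;> linarith [ha'1.1, ha'1.2]
    calc |((a' : ℝ)) - a| = |((a' : ℝ) - xi * (L : ℝ) ^ 2) - ((a : ℝ) - xi * (L : ℝ) ^ 2)| := by ring_nf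
      _ ≤ |(a' : ℝ) - xi * (L : ℝ) ^ 2| + |(a : ℝ) - xi * (L : ℝ) ^ 2| := abs_sub _ _
      _ ≤ 1 + δ' * (L : ℝ) ^ 2 := add_le_add h2 h1
      _ = δ' * (L : ℝ) ^ 2 + 1 := by ring
  have hdistb : |((b' : ℝ)) - b| ≤ δ' * (L : ℝ) ^ 2 + 1 := by
    have h1 : |(b : ℝ) - yj * (L : ℝ) ^ 2| ≤ δ' * (L : ℝ) ^ 2 := by
      have e : (b : ℝ) - yj * (L : ℝ) ^ 2 = ((b : ℝ) / (L : ℝ) ^ 2 - yj) * (L : ℝ) ^ 2 := by field_simp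
      rw [e, abs_mul, abs_of_pos hL2]
      exact mul_le_mul_of_nonneg_right (by rwa [hδ']) hL2.le
    have h2 : |(b' : ℝ) - yj * (L : ℝ) ^ 2| ≤ 1 := by rw [abs_le]; constructor <;> linarith [hb'1.1, hb'1.2]
    calc |((b' : ℝ)) - b| = |((b' : ℝ) - yj * (L : ℝ) ^ 2) - ((b : ℝ) - yj * (L : ℝ) ^ 2)| := by ring_nf
      _ ≤ |(b' : ℝ) - yj * (L : ℝ) ^ 2| + |(b : ℝ) - yj * (L : ℝ) ^ 2| := abs_sub _ _
      _ ≤ 1 + δ' * (L : ℝ) ^ 2 := add_le_add h2 h1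
      _ = δ' * (L : ℝ) ^ 2 + 1 := by ring
  -- (1) the interaction free entropy is `κ`-Lipschitz: from `(a,b)` to `(a',b')`
  have hF1 := abs_interactionEntropy_sub_le_fst hβ t t' hU L (a := a') (a' := a) (b := b) ha'M.le ha hb
  have hF2 := abs_interactionEntropy_sub_le_snd hβ t t' hU L (a := a') (b := b') (b' := b) ha'M.le hb'M.le hb
  -- (2) the binomial entropies against `H_b`
  obtain ⟨hCa1, hCa2⟩ := log_choose_mem_binEntropy hMpos ha
  obtain ⟨hCa'1, hCa'2⟩ := log_choose_mem_binEntropy hMpos ha'M.le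
  obtain ⟨hCb1, hCb2⟩ := log_choose_mem_binEntropy hMpos hb
  obtain ⟨hCb'1, hCb'2⟩ := log_choose_mem_binEntropy hMpos hb'M.le
  -- (3) uniform continuity of `H_b`: the densities of `a` and `a'` are `δ₁`-close
  have hMreal : ((M : ℕ) : ℝ) = (L : ℝ) ^ 2 := by rw [hMdef]; exact hMM
  have hclose : ∀ {c c' : ℕ}, c ≤ L * L → c' ≤ L * L → |((c' : ℝ)) - c| ≤ δ' * (L : ℝ) ^ 2 + 1 →
      |Real.binEntropy ((c : ℝ) / M) - Real.binEntropy ((c' : ℝ) / M)| < ε / 8 := by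
    intro c c' hc hc' hcc'
    have hcI : (c : ℝ) / M ∈ Set.Icc (0 : ℝ) 1 :=
      ⟨by positivity, by rw [hMreal, div_le_one hL2, ← hMM]; exact_mod_cast hc⟩
    have hc'I : (c' : ℝ) / M ∈ Set.Icc (0 : ℝ) 1 :=
      ⟨by positivity, by rw [hMreal, div_le_one hL2, ← hMM]; exact_mod_cast hc'⟩
    have hd : dist ((c : ℝ) / M) ((c' : ℝ) / M) < δ₁ := by
      rw [Real.dist_eq, hMreal, ← sub_div, abs_div, abs_of_pos hL2, div_lt_iff₀ hL2, abs_sub_comm]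
      have h1 : δ' * (L : ℝ) ^ 2 ≤ δ₁ / 2 * (L : ℝ) ^ 2 := mul_le_mul_of_nonneg_right hδ'1 hL2.le
      calc |((c' : ℝ)) - c| ≤ δ' * (L : ℝ) ^ 2 + 1 := hcc'
        _ < δ₁ / 2 * (L : ℝ) ^ 2 + δ₁ / 2 * (L : ℝ) ^ 2 := by linarith
        _ = δ₁ * (L : ℝ) ^ 2 := by ring
    have := hδ _ hcI _ hc'I hd
    rwa [Real.dist_eq] at this
  have hHa := hclose ha ha'M.le hdista
  have hHb := hclose hb hb'M.le hdistb
  rw [abs_lt] at hHa hHb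
  -- (4) the pointwise bound at the net point `(xi, yj)`
  have hnet := hptL (i, j)
  simp only at hnet
  have hnet' : Real.log (partitionFn β (spinSectorHamiltonian a' b' (hubbardRectTorusTT' L L t t' U))).re ≤
      (pressureTT'₂ β t t' U xi yj + ε / 8) * (L : ℝ) ^ 2 := by
    have h := hnet
    rw [spinSectorPressureTT', div_le_iff₀ hL2] at h
    exact h
  -- (5) the Legendre supremum at the net point
  have hsup := pressureTT'₂_add_le_gcPressureTT' hβ t t' hU μ (hu0 i) (hu1 i) (hu0 j) (hu1 j)
  -- (6) the chemical-potential term: `βμ(a+b) ≤ βμ(xi+yj)L² + |βμ|(2δ'L² + 4)`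
  have hμ : β * μ * ((a : ℝ) + b) ≤ β * μ * (xi + yj) * (L : ℝ) ^ 2 + |β * μ| * (2 * (δ' * (L : ℝ) ^ 2 + 1) + 2) := by
    have h1 : |((a : ℝ) + b) - (xi + yj) * (L : ℝ) ^ 2| ≤ 2 * (δ' * (L : ℝ) ^ 2 + 1) + 2 := by
      have e : ((a : ℝ) + b) - (xi + yj) * (L : ℝ) ^ 2 =
          (((a : ℝ)) - a') + (((b : ℝ)) - b') + (((a' : ℝ)) - xi * (L : ℝ) ^ 2) + (((b' : ℝ)) - yj * (L : ℝ) ^ 2) := by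
        ring
      rw [e]
      have h2 : |(a' : ℝ) - xi * (L : ℝ) ^ 2| ≤ 1 := by rw [abs_le]; constructor <;> linarith [ha'1.1, ha'1.2]
      have h3 : |(b' : ℝ) - yj * (L : ℝ) ^ 2| ≤ 1 := by rw [abs_le]; constructor <;> linarith [hb'1.1, hb'1.2]
      have h4 : |((a : ℝ)) - a'| ≤ δ' * (L : ℝ) ^ 2 + 1 := by rw [abs_sub_comm]; exact hdista
      have h5 : |((b : ℝ)) - b'| ≤ δ' * (L : ℝ) ^ 2 + 1 := by rw [abs_sub_comm]; exact hdistb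
      calc _ ≤ |(((a : ℝ)) - a') + (((b : ℝ)) - b') + (((a' : ℝ)) - xi * (L : ℝ) ^ 2)| +
            |((b' : ℝ)) - yj * (L : ℝ) ^ 2| := abs_add_le _ _
        _ ≤ (|(((a : ℝ)) - a') + (((b : ℝ)) - b')| + |((a' : ℝ)) - xi * (L : ℝ) ^ 2|) +
            |((b' : ℝ)) - yj * (L : ℝ) ^ 2| := add_le_add (abs_add_le _ _) le_rfl
        _ ≤ ((|((a : ℝ)) - a'| + |((b : ℝ)) - b'|) + |((a' : ℝ)) - xi * (L : ℝ) ^ 2|) +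
            |((b' : ℝ)) - yj * (L : ℝ) ^ 2| := add_le_add (add_le_add (abs_add_le _ _) le_rfl) le_rfl
        _ ≤ 2 * (δ' * (L : ℝ) ^ 2 + 1) + 2 := by linarith
    have h2 : β * μ * (((a : ℝ) + b) - (xi + yj) * (L : ℝ) ^ 2) ≤ |β * μ| * (2 * (δ' * (L : ℝ) ^ 2 + 1) + 2) := by
      calc _ ≤ |β * μ * (((a : ℝ) + b) - (xi + yj) * (L : ℝ) ^ 2)| := le_abs_self _
        _ = |β * μ| * |((a : ℝ) + b) - (xi + yj) * (L : ℝ) ^ 2| := abs_mul _ _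
        _ ≤ _ := mul_le_mul_of_nonneg_left h1 (abs_nonneg _)
    linarith
  -- (7) assemble: everything over `L²`
  rw [div_le_iff₀ hL2]
  have hZab : Real.log (partitionFn β (spinSectorHamiltonian a b (hubbardRectTorusTT' L L t t' U))).re ≤
      Real.log (partitionFn β (spinSectorHamiltonian a' b' (hubbardRectTorusTT' L L t t' U))).re +
        (Real.log (M.choose a) - Real.log (M.choose a')) +
        (Real.log (M.choose b) - Real.log (M.choose b')) + κ * (2 * (δ' * (L : ℝ) ^ 2 + 1)) := by
    rw [abs_le] at hF1 hF2
    have h1 : κ * |((a : ℝ)) - a'| ≤ κ * (δ' * (L : ℝ) ^ 2 + 1) := by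
      rw [abs_sub_comm]; exact mul_le_mul_of_nonneg_left hdista hκ0
    have h2 : κ * |((b : ℝ)) - b'| ≤ κ * (δ' * (L : ℝ) ^ 2 + 1) := by
      rw [abs_sub_comm]; exact mul_le_mul_of_nonneg_left hdistb hκ0
    linarith [hF1.1, hF1.2, hF2.1, hF2.2]
  have hent : (Real.log (M.choose a) - Real.log (M.choose a')) + (Real.log (M.choose b) - Real.log (M.choose b')) ≤
      ε / 8 * (L : ℝ) ^ 2 + ε / 8 * (L : ℝ) ^ 2 + 4 * Real.log ((L : ℝ) ^ 2 + 1) := by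
    rw [hMreal] at hCa1 hCa2 hCa'1 hCa'2 hCb1 hCb2 hCb'1 hCb'2 hHa hHb
    have e1 := mul_le_mul_of_nonneg_left hHa.2.le hL2.le
    have e2 := mul_le_mul_of_nonneg_left hHb.2.le hL2.le
    linarith [hCa2, hCa'1, hCb2, hCb'1, e1, e2]
  -- make the two partition functions opaque atoms for the final arithmetic
  generalize Real.log (partitionFn β (spinSectorHamiltonian a b (hubbardRectTorusTT' L L t t' U))).re = Z₁ at hZab ⊢
  generalize Real.log (partitionFn β (spinSectorHamiltonian a' b' (hubbardRectTorusTT' L L t t' U))).re = Z₂ at hZab hnet'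
  have e1 : (κ + |β * μ| + 1) * (2 * δ') * (L : ℝ) ^ 2 ≤ ε / 8 * (L : ℝ) ^ 2 :=
    mul_le_mul_of_nonneg_right hδ'2 hL2.le
  have hS' : (pressureTT'₂ β t t' U xi yj + β * μ * (xi + yj)) * (L : ℝ) ^ 2 ≤ S * (L : ℝ) ^ 2 :=
    mul_le_mul_of_nonneg_right hsup hL2.le
  have hδL : 0 ≤ δ' * (L : ℝ) ^ 2 := by positivity
  exact gc_assembly_arith hZab hent hnet' hμ hv1 hv2 hS' e1 hκ0 (abs_nonneg (β * μ)) hδL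

/-! ### §3 The grand-canonical pressure exists and is the Legendre transform -/

/-- **Existence and Legendre form of the grand-canonical pressure**:
`L⁻² log Re Z_β(hubbardRectTorusTT' L L t t' U − μN) → P(β; t,t',U; μ) = sup_{x,y ∈ [0,1)} [p(x,y) + βμ(x+y)]`
(`β ≥ 0`, `U ≥ 0`, every real `μ`). [cite: Ruelle1969, §3.4] [cite: Israel1979, Thm. I.2.4] -/
theorem tendsto_torusGCPressureTT' :
    Tendsto (fun L : ℕ => torusGCPressureTT' β t t' U μ L) atTop (𝓝 (gcPressureTT' β t t' U μ)) := by
  set S := gcPressureTT' β t t' U μ with hS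
  have hH : ∀ L : ℕ, (hubbardRectTorusTT' L L t t' U).IsHermitian := fun L => hubbardRectTorusTT'_isHermitian L L t t' U
  have hP : ∀ L : ℕ, PreservesSectors (hubbardRectTorusTT' L L t t' U) := fun L => by
    unfold hubbardRectTorusTT'
    exact (preservesSectors_hamiltonian _ t U).add (preservesSectors_hamiltonian _ t' 0)
  rw [Metric.tendsto_atTop]
  intro ε hε
  -- lower bound: `S − ε/2 < p(x,y) + βμ(x+y)` for some sector, then its pointwise convergence
  have hne : ((fun z : ℝ × ℝ => pressureTT'₂ β t t' U z.1 z.2 + β * μ * (z.1 + z.2)) ''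
      (Set.Ico (0 : ℝ) 1 ×ˢ Set.Ico (0 : ℝ) 1)).Nonempty :=
    ⟨_, ⟨(0, 0), ⟨⟨le_rfl, one_pos⟩, ⟨le_rfl, one_pos⟩⟩, rfl⟩⟩
  obtain ⟨_, ⟨⟨x, y⟩, ⟨hx, hy⟩, rfl⟩, hlt⟩ := exists_lt_of_lt_csSup hne (by linarith : S - ε / 2 < S)
  simp only at hlt
  have hlow : ∀ᶠ L : ℕ in atTop, S - ε < torusGCPressureTT' β t t' U μ L := by
    have hconv := tendsto_spinSectorPressureTT' hβ t t' hU hx.1 hx.2 hy.1 hy.2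
    have hk : Tendsto (fun L : ℕ => β * μ * (((halfRectN (2 * x) L : ℝ) + halfRectN (2 * y) L) / (L : ℝ) ^ 2))
        atTop (𝓝 (β * μ * (x + y))) := by
      have h := ((tendsto_halfRectN_div_sq₄ (n := 2 * x) (by linarith [hx.1])).add
        (tendsto_halfRectN_div_sq₄ (n := 2 * y) (by linarith [hy.1]))).const_mul (β * μ)
      rw [show 2 * x / 2 + 2 * y / 2 = x + y by ring] at h
      refine h.congr fun L => ?_
      rw [add_div]
    have hsum := hconv.add hk
    have hev := hsum.eventually (Ioi_mem_nhds (by linarith : S - ε < pressureTT'₂ β t t' U x y + β * μ * (x + y)))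
    filter_upwards [hev, eventually_ge_atTop 1] with L hL hL1
    have hL2 : (0 : ℝ) < (L : ℝ) ^ 2 := by
      have : (1 : ℝ) ≤ L := by exact_mod_cast hL1
      positivity
    haveI : Nonempty (Subtype (spinConfig (Λ := Fin L ×ₗ Fin L) (halfRectN (2 * x) L) (halfRectN (2 * y) L))) :=
      nonempty_spinConfig (by rw [card_rectSites]; exact (halfRectN_lt_sq (by linarith [hx.1]) (by linarith [hx.2]) hL1).le)
        (by rw [card_rectSites]; exact (halfRectN_lt_sq (by linarith [hy.1]) (by linarith [hy.2]) hL1).le)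
    have hgc := log_partitionFn_spinSector_le_grandCanonical (hH L) (hP L) β μ
      (a := halfRectN (2 * x) L) (b := halfRectN (2 * y) L)
    rw [torusGCPressureTT', lt_div_iff₀ hL2]
    rw [spinSectorPressureTT', ← mul_div_assoc, ← add_div, lt_div_iff₀ hL2] at hL
    linarith
  -- upper bound from the uniformity lemma
  have hup : ∀ᶠ L : ℕ in atTop, torusGCPressureTT' β t t' U μ L < S + ε := by
    have hunif := eventually_forall_sector_le_sSup hβ t t' hU μ (ε := ε / 4) (by positivity)
    have hvol : ∀ᶠ L : ℕ in atTop, 2 * Real.log ((L : ℝ) ^ 2 + 1) ≤ ε / 4 * (L : ℝ) ^ 2 :=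
      eventually_mul_log_sq_add_one_le (by norm_num) (by positivity)
    filter_upwards [hunif, hvol, eventually_ge_atTop 1] with L hL hv hL1
    have hL2 : (0 : ℝ) < (L : ℝ) ^ 2 := by
      have : (1 : ℝ) ≤ L := by exact_mod_cast hL1
      positivity
    have hMM : ((L * L : ℕ) : ℝ) = (L : ℝ) ^ 2 := by push_cast; ring
    have hB : ∀ a b : ℕ, a ≤ Fintype.card (Fin L ×ₗ Fin L) → b ≤ Fintype.card (Fin L ×ₗ Fin L) →
        Real.exp (β * μ * (a + b)) * (partitionFn β (spinSectorHamiltonian a b (hubbardRectTorusTT' L L t t' U))).re ≤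
          Real.exp ((S + ε / 4) * (L : ℝ) ^ 2) := by
      intro a b ha hb
      rw [card_rectSites] at ha hb
      haveI : Nonempty (Subtype (spinConfig (Λ := Fin L ×ₗ Fin L) a b)) :=
        nonempty_spinConfig (by rw [card_rectSites]; exact ha) (by rw [card_rectSites]; exact hb)
      have hZpos : 0 < (partitionFn β (spinSectorHamiltonian a b (hubbardRectTorusTT' L L t t' U))).re :=
        partitionFn_spinSector_re_pos (hH L) β
      have h := hL a b ha hb
      rw [div_le_iff₀ hL2] at h
      calc _ = Real.exp (β * μ * (a + b) + Real.log (partitionFn β (spinSectorHamiltonian a b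
            (hubbardRectTorusTT' L L t t' U))).re) := by rw [Real.exp_add, Real.exp_log hZpos]
        _ ≤ _ := Real.exp_le_exp.2 h
    have h := log_partitionFn_grandCanonical_le_of_forall (hH L) (hP L) β μ hB
    rw [card_rectSites, hMM] at h
    rw [torusGCPressureTT', div_lt_iff₀ hL2]
    have hpos : 0 < ε / 2 * (L : ℝ) ^ 2 := by positivity
    linarith
  obtain ⟨N, hN⟩ := eventually_atTop.1 (hlow.and hup)
  refine ⟨N, fun L hL => ?_⟩
  obtain ⟨h1, h2⟩ := hN L hL
  rw [Real.dist_eq, abs_lt]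
  constructor <;> linarith

/-- The limit along every side sequence `Ls → ∞` (the form the certificate readers use). [cite: Ruelle1969, §3.4] -/
theorem tendsto_torusGCPressureTT'_comp {Ls : ℕ → ℕ} (hLs : Tendsto Ls atTop atTop) :
    Tendsto (fun j : ℕ => Real.log (partitionFn β (hubbardRectTorusTT' (Ls j) (Ls j) t t' U -
      (μ : ℂ) • totalNumber)).re / ((Ls j : ℕ) : ℝ) ^ 2) atTop (𝓝 (gcPressureTT' β t t' U μ)) :=
  (tendsto_torusGCPressureTT' hβ t t' hU μ).comp hLs

/-- **Grand-canonical CEILINGS are bounds on the number**: if along some `Ls → ∞`, for every `ε > 0` eventually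
`log Re Z_β(H_L − μN) ≤ (q + ε) L²`, then `P(μ) ≤ q` — hence `p(x,y) + βμ(x+y) ≤ q` for every sector and
`pressureTT' n + βμn ≤ q`. [cite: Ruelle1969, §3.4] -/
theorem gcPressureTT'_le_of_eventually {Ls : ℕ → ℕ} (hLs : Tendsto Ls atTop atTop) {q : ℝ}
    (hq : ∀ ε : ℝ, 0 < ε → ∀ᶠ j in atTop,
      Real.log (partitionFn β (hubbardRectTorusTT' (Ls j) (Ls j) t t' U - (μ : ℂ) • totalNumber)).re ≤
        (q + ε) * ((Ls j : ℕ) : ℝ) ^ 2) :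
    gcPressureTT' β t t' U μ ≤ q := by
  have hlim := tendsto_torusGCPressureTT'_comp hβ t t' hU μ hLs
  refine le_of_forall_pos_le_add fun ε hε => ?_
  refine le_of_tendsto hlim ?_
  filter_upwards [hq ε hε, hLs.eventually_ge_atTop 1] with j hj hj1
  have hL2 : (0 : ℝ) < ((Ls j : ℕ) : ℝ) ^ 2 := by
    have : (1 : ℝ) ≤ ((Ls j : ℕ) : ℝ) := by exact_mod_cast hj1
    positivity
  rw [div_le_iff₀ hL2]
  exact hj

/-- **Grand-canonical FLOORS are bounds on the number**: if along some `Ls → ∞`, for every `ε > 0` eventually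
`(W − ε) L² ≤ log Re Z_β(H_L − μN)`, then `W ≤ P(μ)`. [cite: Ruelle1969, §3.4] -/
theorem le_gcPressureTT'_of_eventually {Ls : ℕ → ℕ} (hLs : Tendsto Ls atTop atTop) {W : ℝ}
    (hW : ∀ ε : ℝ, 0 < ε → ∀ᶠ j in atTop,
      (W - ε) * ((Ls j : ℕ) : ℝ) ^ 2 ≤
        Real.log (partitionFn β (hubbardRectTorusTT' (Ls j) (Ls j) t t' U - (μ : ℂ) • totalNumber)).re) :
    W ≤ gcPressureTT' β t t' U μ := by
  have hlim := tendsto_torusGCPressureTT'_comp hβ t t' hU μ hLs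
  refine le_of_forall_pos_le_add fun ε hε => ?_
  have h : W - ε ≤ gcPressureTT' β t t' U μ := by
    refine ge_of_tendsto hlim ?_
    filter_upwards [hW ε hε, hLs.eventually_ge_atTop 1] with j hj hj1
    have hL2 : (0 : ℝ) < ((Ls j : ℕ) : ℝ) ^ 2 := by
      have : (1 : ℝ) ≤ ((Ls j : ℕ) : ℝ) := by exact_mod_cast hj1
      positivity
    rw [le_div_iff₀ hL2]
    exact hj
  linarith

end GC

end ThermodynamicLimit

end Literature.MathematicalPhysics.QuantumLattice
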